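import Summits.Ventures.HodgeRepro2.T5CircleWeights
import Summits.Ventures.HodgeRepro2.T5CharacterBasics

/-!
# T5CircleWeightSpaces — `V = ⨁_{n ∈ ℤ} V_n` and the character as a Laurent polynomial

Support (seat p1, blind lane) for route/T5-N4-p5.md v10 (N4.3 = (R3), rows P2′ «the SO(2)-weights are
exactly {3, 5, 7, …}, each once» — the principle behind «read off from the character»): for a
continuous finite-dimensional representation `π` of `Circle`, the integer weight spaces
`V_n = weightSpace π (zpowChar n)` are INDEPENDENT, only finitely many are non-zero, they form an
internal direct sum `V = ⨁_{n ∈ ℤ} V_n`, and the character is the Laurent polynomial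
`χ_π(z) = Σ_n (dim V_n) · z ^ n`; in particular `Σ_n dim V_n = dim V` and the set of weights is
read off from the non-zero coefficients of the character.

Method: `V_n` lies in the `z₀^n`-eigenspace of the single operator `π z₀`, `z₀ := exp(i)`, whose
integer powers are pairwise distinct because `π` is irrational (`irrational_pi`); eigenspaces of one
operator for distinct eigenvalues are independent (Mathlib `Module.End.eigenspaces_iSupIndep`), and
an independent family in a Noetherian module has finite support. The character formula is
Mathlib's `LinearMap.trace_eq_sum_trace_restrict'` over the internal direct sum.

Honest scope: nothing about (N), U(1,1), π₃⁺ or the particular weights {3, 5, 7, …}.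
-/

namespace Summit.Ventures.HodgeRepro2.T5CircleWeightSpaces

open Summit.Ventures.HodgeRepro2 T5CircleWeights Complex

/-- The integer powers of `z₀ = exp(i)` are pairwise distinct: `π` is irrational. -/
theorem exp_one_zpow_injective : Function.Injective fun n : ℤ => ((Circle.exp 1 : Circle) : ℂ) ^ n := by
  intro n m h
  simp only at h
  have h' : (Circle.exp 1) ^ n = (Circle.exp 1) ^ m := Circle.coe_injective (by simpa using h)
  rw [← Circle.exp_intCast_mul, ← Circle.exp_intCast_mul, Circle.exp_eq_exp] at h'
  obtain ⟨k, hk⟩ := h'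
  by_contra hne
  have hk0 : k ≠ 0 := by
    rintro rfl
    apply hne
    have : (n : ℝ) = m := by simpa using hk
    exact_mod_cast this
  have hk0' : (2 * k : ℤ) ≠ 0 := by omega
  apply (irrational_iff_ne_rational Real.pi).1 irrational_pi (n - m) (2 * k) hk0'
  have hk2 : ((2 * k : ℤ) : ℝ) ≠ 0 := by exact_mod_cast hk0'
  rw [eq_div_iff hk2]
  push_cast
  linarith

section Rep

variable {V : Type*} [NormedAddCommGroup V] [InnerProductSpace ℂ V] [FiniteDimensional ℂ V]
  (π : Circle →* V →L[ℂ] V)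

omit [FiniteDimensional ℂ V] in
/-- `V_n` is contained in the `z ^ n`-eigenspace of the single operator `π z`. -/
theorem weightSpace_zpowChar_le_eigenspace (z : Circle) (n : ℤ) :
    T5WeightSpaces.weightSpace π (zpowChar n) ≤
      Module.End.eigenspace (π z : V →ₗ[ℂ] V) ((z : ℂ) ^ n) := by
  intro v hv
  rw [Module.End.mem_eigenspace_iff]
  have := (T5WeightSpaces.mem_weightSpace π (zpowChar n)).1 hv z
  simpa [coe_zpowChar_apply] using this

omit [FiniteDimensional ℂ V] in
/-- The integer weight spaces of a representation of `Circle` are independent. -/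
theorem iSupIndep_weightSpace_zpowChar :
    iSupIndep fun n : ℤ => T5WeightSpaces.weightSpace π (zpowChar n) := by
  have h1 := (Module.End.eigenspaces_iSupIndep (π (Circle.exp 1) : V →ₗ[ℂ] V)).comp
    exp_one_zpow_injective
  exact h1.mono fun n => weightSpace_zpowChar_le_eigenspace π (Circle.exp 1) n

/-- Only finitely many integer weight spaces are non-zero. -/
theorem finite_setOf_weightSpace_zpowChar_ne_bot :
    {n : ℤ | T5WeightSpaces.weightSpace π (zpowChar n) ≠ ⊥}.Finite :=
  Submodule.finite_ne_bot_of_iSupIndep (iSupIndep_weightSpace_zpowChar π)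

/-- The finite set of weights of `π`: the integers `n` with `V_n ≠ ⊥`. -/
noncomputable def weights : Finset ℤ := (finite_setOf_weightSpace_zpowChar_ne_bot π).toFinset

/-- `n ∈ weights π ↔ V_n ≠ ⊥`. -/
theorem mem_weights {n : ℤ} : n ∈ weights π ↔ T5WeightSpaces.weightSpace π (zpowChar n) ≠ ⊥ := by
  simp [weights]

omit [FiniteDimensional ℂ V] in
/-- `π z` maps `V_n` into itself (by the scalar `z ^ n`). -/
theorem mapsTo_weightSpace_zpowChar (z : Circle) (n : ℤ) :
    Set.MapsTo (π z : V →ₗ[ℂ] V) (T5WeightSpaces.weightSpace π (zpowChar n))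
      (T5WeightSpaces.weightSpace π (zpowChar n)) := by
  intro v hv
  have h := (T5WeightSpaces.mem_weightSpace π (zpowChar n)).1 hv z
  simp only [SetLike.mem_coe, ContinuousLinearMap.coe_coe]
  rw [h]
  exact Submodule.smul_mem _ _ hv

omit [FiniteDimensional ℂ V] in
/-- On `V_n` the operator `π z` is the scalar `z ^ n`. -/
theorem restrict_eq_smul_id (z : Circle) (n : ℤ) :
    (π z : V →ₗ[ℂ] V).restrict (mapsTo_weightSpace_zpowChar π z n) =
      ((z : ℂ) ^ n) • LinearMap.id := by
  ext ⟨v, hv⟩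
  have h := (T5WeightSpaces.mem_weightSpace π (zpowChar n)).1 hv z
  simp only [LinearMap.restrict_apply, ContinuousLinearMap.coe_coe, LinearMap.smul_apply,
    LinearMap.id_apply, Submodule.coe_smul]
  rw [h]
  simp

/-- The weights are read off from the character: `n` is a weight iff the coefficient of `z ^ n` in
`χ_π` is non-zero, i.e. iff `dim V_n ≠ 0`. -/
theorem mem_weights_iff_finrank_ne_zero {n : ℤ} :
    n ∈ weights π ↔ Module.finrank ℂ (T5WeightSpaces.weightSpace π (zpowChar n)) ≠ 0 := by
  rw [mem_weights, Ne, Ne, Submodule.finrank_eq_zero]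

variable [MeasurableSpace Circle] [BorelSpace Circle] (hπ : Continuous π)

include hπ in
/-- `V = ⨁_{n ∈ ℤ} V_n` as an internal direct sum. -/
theorem isInternal_weightSpace_zpowChar :
    DirectSum.IsInternal fun n : ℤ => T5WeightSpaces.weightSpace π (zpowChar n) :=
  (DirectSum.isInternal_submodule_iff_iSupIndep_and_iSup_eq_top _).2
    ⟨iSupIndep_weightSpace_zpowChar π, iSup_weightSpace_zpowChar_eq_top π hπ⟩

include hπ in
/-- THE CHARACTER IS A LAURENT POLYNOMIAL WITH THE MULTIPLICITIES AS COEFFICIENTS: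
`χ_π(z) = Σ_{n ∈ weights π} (dim V_n) · z ^ n`. -/
theorem character_eq_sum_finrank_zpow (z : Circle) :
    T5SchurOrthogonality.character π z =
      ∑ n ∈ weights π,
        (Module.finrank ℂ (T5WeightSpaces.weightSpace π (zpowChar n)) : ℂ) * (z : ℂ) ^ n := by
  have h := LinearMap.trace_eq_sum_trace_restrict' (isInternal_weightSpace_zpowChar π hπ)
    (finite_setOf_weightSpace_zpowChar_ne_bot π) (f := (π z : V →ₗ[ℂ] V))
    (mapsTo_weightSpace_zpowChar π z)
  change LinearMap.trace ℂ V (π z : V →ₗ[ℂ] V) = _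
  rw [h]
  apply Finset.sum_congr rfl
  intro n _
  rw [restrict_eq_smul_id, map_smul, LinearMap.trace_id, smul_eq_mul, mul_comm]

include hπ in
/-- `Σ_{n ∈ weights π} dim V_n = dim V`. -/
theorem sum_finrank_weightSpace_zpowChar :
    ∑ n ∈ weights π, Module.finrank ℂ (T5WeightSpaces.weightSpace π (zpowChar n)) =
      Module.finrank ℂ V := by
  have h := character_eq_sum_finrank_zpow π hπ 1
  rw [T5CharacterBasics.character_one] at h
  simp only [Circle.coe_one, one_zpow, mul_one] at h
  exact_mod_cast h.symm

include hπ in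
/-- For a non-trivial space the weight set is non-empty. -/
theorem weights_nonempty [Nontrivial V] : (weights π).Nonempty := by
  by_contra hempty
  rw [Finset.not_nonempty_iff_eq_empty] at hempty
  have h := sum_finrank_weightSpace_zpowChar π hπ
  rw [hempty, Finset.sum_empty] at h
  exact (Module.finrank_pos (R := ℂ) (M := V)).ne h

end Rep

end Summit.Ventures.HodgeRepro2.T5CircleWeightSpaces
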